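import Mathlib
import Literature.Analysis.Complex.TaylorCoefficientsAlgebra
import Literature.Analysis.Complex.DecomposableCauchyBound
import HarnessLib

/-!
# Convergence of a formal power series whose pullback by a local biholomorphism converges

`Literature/Analysis/Complex/PullbackConvergence.lean`. Everything here is PROVED (no definition,
no named fact). In F. Calegari, V. Dimitrov, Y. Tang, *The unbounded denominators conjecture*
(J. Amer. Math. Soc. **38** (2025), 627–702; arXiv:2109.09040), §2.1, the hypotheses of the
arithmetic holonomy bound (Theorem 2.0.1) concern formal power series `f_i ∈ ℚ⟦x⟧` whose pullbacks
`φ^* f_i = f_i(φ(z))` by a holomorphic map `φ` with `φ(0) = 0`, `|φ'(0)| > 1` are holomorphic on a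
neighbourhood of the closed unit disc; the proof of Lemma 2.1.1 uses that then "by (2.3)" — the
inverse function theorem, "`φ : φ⁻¹(D(0,ρ))₀ ≅ D(0,ρ)` is an analytic isomorphism" — "every power
series `f_i(x) ∈ ℚ⟦x⟧` is convergent on the archimedean disc `|x| < ρ`", whence the geometric
coefficient bounds fed into Siegel's lemma. We formalize this deduction over `ℂ`, with the Taylor
power series `𝓣 u = ∑ₙ (u⁽ⁿ⁾(0)/n!) Tⁿ` of `Literature/Analysis/Complex/TaylorCoefficientsAlgebra`:

* `exists_analytic_rightInverse` — a local analytic right inverse `ψ` of `φ` at `0`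
  (Mathlib's `AnalyticAt.analyticAt_localInverse`);
* `eq_taylorPowerSeries_comp_of_subst_eq` — if `f(𝓣 φ) = 𝓣 g` with `g` analytic at `0`, then
  `f = 𝓣 (g ∘ ψ)` (formal substitution is composition: `taylorPowerSeries_comp`);
* `exists_norm_taylorCoeff_le` — Cauchy's estimate: an analytic germ has Taylor coefficients
  `≤ C r⁻ⁿ` for some `r > 0`;
* `exists_norm_coeff_le_of_subst_eq` — hence such an `f` has coefficients `‖[xⁿ] f‖ ≤ C r⁻ⁿ`;
  `exists_uniform_norm_coeff_le` makes `r, C` uniform over a finite family.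

## References

* [CalegariDimitrovTang2025] F. Calegari, V. Dimitrov, Y. Tang, The unbounded denominators
  conjecture, J. Amer. Math. Soc. 38 (2025), no. 3, 627–702, §2.1, display (2.3) and the proof of
  Lemma 2.1.1; arXiv:2109.09040.
-/

noncomputable section

open Metric Set Filter Topology

namespace Literature.Analysis.Complex

/-! ### 1. The local analytic inverse -/

/-- `𝓣(z ↦ z) = X`. [folklore] -/
theorem taylorPowerSeries_id' :
    PowerSeries.mk (fun n ↦ iteratedDeriv n (fun z : ℂ ↦ z) 0 / n.factorial) = PowerSeries.X := by
  have h := taylorPowerSeries_pow_id 1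
  simp only [pow_one] at h
  exact h

/-- **A local analytic right inverse** (the inverse function theorem (2.3) of CDT): for `φ`
analytic at `0` with `φ(0) = 0` and `φ'(0) ≠ 0` there is `ψ` analytic at `0` with `ψ(0) = 0` and
`φ(ψ(w)) = w` for `w` near `0`. [folklore] -/
theorem exists_analytic_rightInverse {φ : ℂ → ℂ} (hφ : AnalyticAt ℂ φ 0) (hφ0 : φ 0 = 0)
    (hφ' : deriv φ 0 ≠ 0) :
    ∃ ψ : ℂ → ℂ, AnalyticAt ℂ ψ 0 ∧ ψ 0 = 0 ∧ (fun w ↦ φ (ψ w)) =ᶠ[𝓝 0] fun w ↦ w := by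
  set ψ := hφ.hasStrictDerivAt.localInverse φ (deriv φ 0) 0 hφ' with hψ
  have hψan : AnalyticAt ℂ ψ (φ 0) := hφ.analyticAt_localInverse hφ'
  have hright : ∀ᶠ w in 𝓝 (φ 0), φ (ψ w) = w :=
    HasStrictDerivAt.eventually_right_inverse ..
  have hψ0 : ψ (φ 0) = 0 := HasStrictFDerivAt.localInverse_apply_image ..
  rw [hφ0] at hψan hright hψ0
  exact ⟨ψ, hψan, hψ0, hright⟩

/-! ### 2. Formal pullback is the Taylor series of the composite -/

/-- **`f(𝓣φ) = 𝓣g` forces `f = 𝓣(g ∘ ψ)`** for a local right inverse `ψ` of `φ`: a formal power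
series whose formal pullback by `φ` is the Taylor series of an analytic germ is itself the Taylor
series of an analytic germ. [cite: CalegariDimitrovTang2025, §2.1, (2.3) and proof of Lemma 2.1.1] -/
theorem eq_taylorPowerSeries_comp_of_subst_eq {f : PowerSeries ℂ} {φ g ψ : ℂ → ℂ}
    (hφ : AnalyticAt ℂ φ 0) (hφ0 : φ 0 = 0) (hg : AnalyticAt ℂ g 0)
    (hψ : AnalyticAt ℂ ψ 0) (hψ0 : ψ 0 = 0) (hφψ : (fun w ↦ φ (ψ w)) =ᶠ[𝓝 0] fun w ↦ w)
    (hfg : f.subst (PowerSeries.mk fun n ↦ iteratedDeriv n φ 0 / n.factorial) =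
      PowerSeries.mk fun n ↦ iteratedDeriv n g 0 / n.factorial) :
    f = PowerSeries.mk fun n ↦ iteratedDeriv n (g ∘ ψ) 0 / n.factorial := by
  have hTφ0 : PowerSeries.constantCoeff
      (PowerSeries.mk fun n ↦ iteratedDeriv n φ 0 / n.factorial) = 0 := by
    rw [constantCoeff_taylorPowerSeries, hφ0]
  have hTψ0 : PowerSeries.constantCoeff
      (PowerSeries.mk fun n ↦ iteratedDeriv n ψ 0 / n.factorial) = 0 := by
    rw [constantCoeff_taylorPowerSeries, hψ0]
  have hsφ := PowerSeries.HasSubst.of_constantCoeff_zero' hTφ0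
  have hsψ := PowerSeries.HasSubst.of_constantCoeff_zero' hTψ0
  have hcomp : (φ ∘ ψ) =ᶠ[𝓝 0] fun z : ℂ ↦ z := hφψ
  symm
  calc PowerSeries.mk (fun n ↦ iteratedDeriv n (g ∘ ψ) 0 / n.factorial)
      = PowerSeries.subst (PowerSeries.mk fun n ↦ iteratedDeriv n ψ 0 / n.factorial)
          (PowerSeries.mk fun n ↦ iteratedDeriv n g 0 / n.factorial) :=
        taylorPowerSeries_comp hg hψ hψ0
    _ = PowerSeries.subst (PowerSeries.mk fun n ↦ iteratedDeriv n ψ 0 / n.factorial)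
          (f.subst (PowerSeries.mk fun n ↦ iteratedDeriv n φ 0 / n.factorial)) := by rw [hfg]
    _ = f.subst (PowerSeries.subst (PowerSeries.mk fun n ↦ iteratedDeriv n ψ 0 / n.factorial)
          (PowerSeries.mk fun n ↦ iteratedDeriv n φ 0 / n.factorial)) :=
        PowerSeries.subst_comp_subst_apply hsφ hsψ f
    _ = f.subst (PowerSeries.mk fun n ↦ iteratedDeriv n (φ ∘ ψ) 0 / n.factorial) := by
        rw [taylorPowerSeries_comp hφ hψ hψ0]
    _ = f.subst (PowerSeries.mk fun n ↦ iteratedDeriv n (fun z : ℂ ↦ z) 0 / n.factorial) := by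
        rw [taylorPowerSeries_congr hcomp]
    _ = f := by rw [taylorPowerSeries_id', PowerSeries.X_subst]

/-! ### 3. Cauchy's estimate for an analytic germ -/

/-- **Cauchy's estimate at a point**: an analytic germ at `0` has Taylor coefficients bounded by
`C r⁻ⁿ` for some `r > 0`, `C ≥ 0`. [folklore] -/
theorem exists_norm_taylorCoeff_le {G : ℂ → ℂ} (hG : AnalyticAt ℂ G 0) :
    ∃ r > 0, ∃ C ≥ 0, ∀ n, ‖iteratedDeriv n G 0 / n.factorial‖ ≤ C / r ^ n := by
  obtain ⟨ε, hε, hball⟩ := Metric.eventually_nhds_iff_ball.mp hG.eventually_analyticAt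
  have hr : 0 < ε / 2 := by positivity
  have hsub : closedBall (0 : ℂ) (ε / 2) ⊆ ball 0 ε := closedBall_subset_ball (by linarith)
  have hdiff : DifferentiableOn ℂ G (closedBall 0 (ε / 2)) := fun z hz ↦
    (hball z (hsub hz)).differentiableAt.differentiableWithinAt
  have hdc : DiffContOnCl ℂ G (ball 0 (ε / 2)) :=
    DifferentiableOn.diffContOnCl (by rw [closure_ball 0 hr.ne']; exact hdiff)
  obtain ⟨C, hC⟩ := (isCompact_sphere (0 : ℂ) (ε / 2)).exists_bound_of_continuousOn
    (hdiff.continuousOn.mono sphere_subset_closedBall)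
  refine ⟨ε / 2, hr, max C 0, le_max_right _ _, fun n ↦ ?_⟩
  exact norm_taylorCoeff_le_of_forall_mem_sphere_norm_le hr hdc
    (fun z hz ↦ (hC z hz).trans (le_max_left _ _)) n

/-- **Convergence of `f` from convergence of `φ^* f`** (CDT: "by (2.3), every power series
`f_i(x) ∈ ℚ⟦x⟧ is convergent on the archimedean disc `|x| < ρ`"): if `f(𝓣φ) = 𝓣g` for `φ, g`
analytic at `0`, `φ(0) = 0`, `φ'(0) ≠ 0`, then `‖[xⁿ] f‖ ≤ C r⁻ⁿ` for some `r > 0`, `C ≥ 0`.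
[cite: CalegariDimitrovTang2025, §2.1, (2.3) and proof of Lemma 2.1.1] -/
theorem exists_norm_coeff_le_of_subst_eq {f : PowerSeries ℂ} {φ g : ℂ → ℂ}
    (hφ : AnalyticAt ℂ φ 0) (hφ0 : φ 0 = 0) (hφ' : deriv φ 0 ≠ 0) (hg : AnalyticAt ℂ g 0)
    (hfg : f.subst (PowerSeries.mk fun n ↦ iteratedDeriv n φ 0 / n.factorial) =
      PowerSeries.mk fun n ↦ iteratedDeriv n g 0 / n.factorial) :
    ∃ r > 0, ∃ C ≥ 0, ∀ n, ‖PowerSeries.coeff n f‖ ≤ C / r ^ n := by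
  obtain ⟨ψ, hψ, hψ0, hφψ⟩ := exists_analytic_rightInverse hφ hφ0 hφ'
  have hf := eq_taylorPowerSeries_comp_of_subst_eq hφ hφ0 hg hψ hψ0 hφψ hfg
  have hgψ : AnalyticAt ℂ (g ∘ ψ) 0 := AnalyticAt.comp_of_eq hg hψ hψ0
  obtain ⟨r, hr, C, hC, hb⟩ := exists_norm_taylorCoeff_le hgψ
  refine ⟨r, hr, C, hC, fun n ↦ ?_⟩
  rw [hf, PowerSeries.coeff_mk]
  exact hb n

/-- Uniform radius and constant for a finite family. [folklore] -/
theorem exists_uniform_norm_coeff_le {ι : Type*} [Fintype ι] {F : ι → PowerSeries ℂ}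
    (h : ∀ i, ∃ r > 0, ∃ C ≥ 0, ∀ n, ‖PowerSeries.coeff n (F i)‖ ≤ C / r ^ n) :
    ∃ r > 0, ∃ C ≥ 0, ∀ i n, ‖PowerSeries.coeff n (F i)‖ ≤ C / r ^ n := by
  classical
  choose r hr C hC hb using h
  rcases isEmpty_or_nonempty ι with hι | hι
  · exact ⟨1, one_pos, 0, le_rfl, fun i ↦ (IsEmpty.false i).elim⟩
  · have hne : (Finset.univ : Finset ι).Nonempty := Finset.univ_nonempty
    obtain ⟨i₀, -, hi₀⟩ := Finset.exists_mem_eq_inf' hne r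
    have hr₀le : ∀ i, Finset.univ.inf' hne r ≤ r i := fun i ↦ Finset.inf'_le r (Finset.mem_univ i)
    have hr₀pos : 0 < Finset.univ.inf' hne r := by rw [hi₀]; exact hr i₀
    refine ⟨Finset.univ.inf' hne r, hr₀pos, ∑ i, C i, Finset.sum_nonneg fun i _ ↦ hC i,
      fun i n ↦ ?_⟩
    calc ‖PowerSeries.coeff n (F i)‖ ≤ C i / r i ^ n := hb i n
      _ ≤ (∑ j, C j) / Finset.univ.inf' hne r ^ n := by
          have h1 : C i ≤ ∑ j, C j := Finset.single_le_sum (fun j _ ↦ hC j) (Finset.mem_univ i)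
          have h2 : Finset.univ.inf' hne r ^ n ≤ r i ^ n :=
            pow_le_pow_left₀ hr₀pos.le (hr₀le i) n
          exact div_le_div₀ (Finset.sum_nonneg fun j _ ↦ hC j) h1 (pow_pos hr₀pos n) h2

end Literature.Analysis.Complex
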